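import Summits.QuantumFields.QCD.Theorems.SpectralDefectExtinctionWindowExtinctionStubFiberAtomMonotonePatterns
import Mathlib.MeasureTheory.Constructions.Pi

/-!
# Representative coupling and the fibre bound, monotone form

Helper (2/2) for stub `stub_fiberAtomMonotone` (S4″, reshape r3) of line
`free-volume-heavy-witness` (crux
`Summit.QuantumFields.QCD.Theses.SpectralDefectExtinction.WindowExtinction`,
item stmt-QuantumFields-8964).  Pure measure theory, no project vocabulary.

* `fam_coupling_identity` — on `J → T` with the product `ν^{⊗J}` of a probability measure, two
  disjoint measurable template classes `Tp, Tm ⊆ T` and weights `Fᵢ ≥ 0`: drawing two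
  independent representative configurations `qp ~ ⊗ᵢ 1_{Tp}Fᵢν`, `qm ~ ⊗ᵢ 1_{Tm}Fᵢν` and mixing
  them along a pattern `σ` realises the law `⊗ᵢ 1_{T(σᵢ)}Fᵢν` (`T(tt) = Tp`, `T(ff) = Tm`), the
  unused representatives integrating to their masses; the proof is a coordinatewise swap, which
  preserves `ν^{⊗J} ⊗ ν^{⊗J}` (Mathlib `measurePreserving_pi`,
  `measurePreserving_arrowProdEquivProdArrow`);
* `fam_fiber_core` — consequently, if an integer statistic `Y` increases by at least one under
  every single `Tm → Tp` refill, the `∏ᵢ Fᵢ`-mass of an atom `{Y = j}` on the active box is at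
  most `c` times the total mass as soon as every antichain of patterns has one-coordinate-mass
  weight at most `c` times the total pattern weight: pointwise in the representatives the level
  set `{σ | Y(q^σ) = j}` is an antichain (`fam_mix_antichain`).
-/

noncomputable section

namespace Summit.QuantumFields.QCD.Cruxes.WindowExtinction.FreeVolumeHeavyWitness

open MeasureTheory Set Function
open scoped ENNReal BigOperators Classical

/-! ## The representative coupling -/

variable {J T : Type*} [Fintype J] [MeasurableSpace T]

/-- **Representative coupling.** For a pattern `σ`, mixing two independent representative
configurations `qp ~ ⊗ᵢ 1_{Tp}Fᵢν` and `qm ~ ⊗ᵢ 1_{Tm}Fᵢν` along `σ` realises the law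
`⊗ᵢ 1_{T(σᵢ)}Fᵢν`, the unused representatives integrating to their total masses:
`∫∫ h(q^σ) ∏ᵢ 1_{Tp}Fᵢ(qpᵢ) ∏ᵢ 1_{Tm}Fᵢ(qmᵢ) = (∏ᵢ ∫ 1_{T(¬σᵢ)}Fᵢ) ∫ h ∏ᵢ 1_{T(σᵢ)}Fᵢ`.
(The coordinatewise swap along `σ` preserves `ν^{⊗J} ⊗ ν^{⊗J}`.) -/
theorem fam_coupling_identity (ν : Measure T) [IsProbabilityMeasure ν] {Tp Tm : Set T}
    (hTp : MeasurableSet Tp) (hTm : MeasurableSet Tm)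
    {F : J → T → ℝ≥0∞} (hF : ∀ i, Measurable (F i)) {h : (J → T) → ℝ≥0∞} (hh : Measurable h)
    (σ : J → Bool) :
    ∫⁻ z, h (fun i => if σ i then z.1 i else z.2 i) *
        ((∏ i, Tp.indicator (F i) (z.1 i)) * ∏ i, Tm.indicator (F i) (z.2 i))
        ∂(Measure.pi fun _ : J => ν).prod (Measure.pi fun _ : J => ν) =
      (∏ i, ∫⁻ u, (if σ i then Tm else Tp).indicator (F i) u ∂ν) *
        ∫⁻ q, h q * ∏ i, (if σ i then Tp else Tm).indicator (F i) (q i)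
          ∂Measure.pi (fun _ : J => ν) := by
  set μJ : Measure (J → T) := Measure.pi fun _ : J => ν with hμJ
  have hTσ : ∀ i, MeasurableSet (if σ i then Tp else Tm) := fun i => by
    cases σ i <;> simp [hTp, hTm]
  have hTσ' : ∀ i, MeasurableSet (if σ i then Tm else Tp) := fun i => by
    cases σ i <;> simp [hTp, hTm]
  -- the coordinatewise swap along `σ`, conjugated to the product of the two copies
  set E : (J → T × T) ≃ᵐ (J → T) × (J → T) := MeasurableEquiv.arrowProdEquivProdArrow T T J
    with hE_def
  have hE : MeasurePreserving E (Measure.pi fun _ : J => ν.prod ν) (μJ.prod μJ) :=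
    measurePreserving_arrowProdEquivProdArrow T T J (fun _ => ν) (fun _ => ν)
  set sw : Bool → T × T → T × T := fun β p => bif β then p else p.swap with hsw_def
  have hsw : ∀ β, MeasurePreserving (sw β) (ν.prod ν) (ν.prod ν) := by
    rintro (_ | _)
    · exact Measure.measurePreserving_swap
    · exact MeasurePreserving.id _
  set M : (J → T × T) → (J → T × T) := fun y i => sw (σ i) (y i) with hM_def
  have hM : MeasurePreserving M (Measure.pi fun _ : J => ν.prod ν)
      (Measure.pi fun _ : J => ν.prod ν) :=
    measurePreserving_pi (fun _ : J => ν.prod ν) (fun _ : J => ν.prod ν) fun i => hsw (σ i)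
  have hΞ : MeasurePreserving (E ∘ M ∘ E.symm) (μJ.prod μJ) (μJ.prod μJ) :=
    hE.comp (hM.comp (MeasurePreserving.symm E hE))
  have hΞ_apply : ∀ z : (J → T) × (J → T), (E ∘ M ∘ E.symm) z =
      ((fun i => if σ i then z.1 i else z.2 i), (fun i => if σ i then z.2 i else z.1 i)) := by
    intro z
    refine Prod.ext (funext fun i => ?_) (funext fun i => ?_)
    · show (sw (σ i) (z.1 i, z.2 i)).1 = if σ i then z.1 i else z.2 i
      cases σ i <;> rfl
    · show (sw (σ i) (z.1 i, z.2 i)).2 = if σ i then z.2 i else z.1 i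
      cases σ i <;> rfl
  -- the integrand is a product function composed with the swap
  set Θ : (J → T) × (J → T) → ℝ≥0∞ := fun w =>
    (h w.1 * ∏ i, (if σ i then Tp else Tm).indicator (F i) (w.1 i)) *
      ∏ i, (if σ i then Tm else Tp).indicator (F i) (w.2 i) with hΘ_def
  have hΘm : Measurable Θ := by
    refine ((hh.comp measurable_fst).mul ?_).mul ?_
    · exact Finset.measurable_prod
        (f := fun (i : J) (w : (J → T) × (J → T)) => (if σ i then Tp else Tm).indicator (F i) (w.1 i))
        _ fun i _ => ((hF i).indicator (hTσ i)).comp ((measurable_pi_apply i).comp measurable_fst)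
    · exact Finset.measurable_prod
        (f := fun (i : J) (w : (J → T) × (J → T)) => (if σ i then Tm else Tp).indicator (F i) (w.2 i))
        _ fun i _ => ((hF i).indicator (hTσ' i)).comp ((measurable_pi_apply i).comp measurable_snd)
  have hpt : ∀ z : (J → T) × (J → T),
      h (fun i => if σ i then z.1 i else z.2 i) *
          ((∏ i, Tp.indicator (F i) (z.1 i)) * ∏ i, Tm.indicator (F i) (z.2 i)) =
        Θ ((E ∘ M ∘ E.symm) z) := by
    intro z
    rw [hΞ_apply, hΘ_def]
    dsimp only
    rw [mul_assoc]
    congr 1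
    rw [← Finset.prod_mul_distrib, ← Finset.prod_mul_distrib]
    refine Finset.prod_congr rfl fun i _ => ?_
    cases σ i <;> simp [mul_comm]
  have hΦm : Measurable fun q : J → T => h q * ∏ i, (if σ i then Tp else Tm).indicator (F i) (q i) :=
    hh.mul (Finset.measurable_prod
      (f := fun (i : J) (q : J → T) => (if σ i then Tp else Tm).indicator (F i) (q i))
      _ fun i _ => ((hF i).indicator (hTσ i)).comp (measurable_pi_apply i))
  have hΨm : Measurable fun q : J → T => ∏ i, (if σ i then Tm else Tp).indicator (F i) (q i) :=
    Finset.measurable_prod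
      (f := fun (i : J) (q : J → T) => (if σ i then Tm else Tp).indicator (F i) (q i))
      _ fun i _ => ((hF i).indicator (hTσ' i)).comp (measurable_pi_apply i)
  calc ∫⁻ z, h (fun i => if σ i then z.1 i else z.2 i) *
        ((∏ i, Tp.indicator (F i) (z.1 i)) * ∏ i, Tm.indicator (F i) (z.2 i)) ∂μJ.prod μJ
      = ∫⁻ z, Θ ((E ∘ M ∘ E.symm) z) ∂μJ.prod μJ := lintegral_congr hpt
    _ = ∫⁻ w, Θ w ∂μJ.prod μJ := hΞ.lintegral_comp hΘm
    _ = (∫⁻ q, h q * ∏ i, (if σ i then Tp else Tm).indicator (F i) (q i) ∂μJ) *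
          ∫⁻ q, ∏ i, (if σ i then Tm else Tp).indicator (F i) (q i) ∂μJ := by
        rw [hΘ_def]
        exact lintegral_prod_mul hΦm.aemeasurable hΨm.aemeasurable
    _ = (∏ i, ∫⁻ u, (if σ i then Tm else Tp).indicator (F i) u ∂ν) *
          ∫⁻ q, h q * ∏ i, (if σ i then Tp else Tm).indicator (F i) (q i) ∂μJ := by
        rw [spread_lintegral_prod_pi ν (g := fun i => (if σ i then Tm else Tp).indicator (F i))
          (fun i => (hF i).indicator (hTσ' i)), mul_comm]

/-! ## The fibre bound -/

/-- **Fibre core, monotone form.** On `J → T` with the product of a probability measure `ν`,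
measurable weights `Fᵢ ≥ 0` with finite positive one-coordinate masses
`Gᵢ(β) = ∫ 1_{T(β)} Fᵢ dν` (`T(tt) = Tp`, `T(ff) = Tm` disjoint measurable), and a measurable
integer statistic `Y` with `Y q + 1 ≤ Y (q[i ↦ u])` whenever `q` is active, `q i ∈ Tm` and
`u ∈ Tp`: if every antichain of patterns has `G`-weight at most `c` times the total pattern
weight, then every atom of `Y` has `∏ F`-mass on the active box at most `c` times the total:
`∫_{active, Y = j} ∏ᵢ Fᵢ ≤ c ∫_{active} ∏ᵢ Fᵢ`. -/
theorem fam_fiber_core :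
    ∀ {J T : Type*} [Fintype J] [DecidableEq J] [MeasurableSpace T]
      (ν : Measure T) [IsProbabilityMeasure ν] {Tp Tm : Set T},
      MeasurableSet Tp → MeasurableSet Tm → Disjoint Tp Tm →
      ∀ {F : J → T → ENNReal}, (∀ i, Measurable (F i)) →
      (∀ (i : J) (β : Bool), ∫⁻ u, (if β then Tp else Tm).indicator (F i) u ∂ν ≠ ⊤) →
      (∀ (i : J) (β : Bool), ∫⁻ u, (if β then Tp else Tm).indicator (F i) u ∂ν ≠ 0) →
      ∀ {Y : (J → T) → ℤ}, Measurable Y →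
      (∀ q : J → T, (∀ i, q i ∈ Tp ∪ Tm) → ∀ i, ∀ u ∈ Tp, q i ∈ Tm →
        Y q + 1 ≤ Y (Function.update q i u)) →
      ∀ {c : ENNReal},
      (∀ 𝒜 : Finset (J → Bool), (∀ s ∈ 𝒜, ∀ s' ∈ 𝒜, (∀ i, s i ≤ s' i) → s = s') →
        ∑ σ ∈ 𝒜, ∏ i, ∫⁻ u, (if σ i then Tp else Tm).indicator (F i) u ∂ν ≤
          c * ∑ σ : J → Bool, ∏ i, ∫⁻ u, (if σ i then Tp else Tm).indicator (F i) u ∂ν) →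
      ∀ (j : ℤ),
      ∫⁻ q, (Set.pi Set.univ fun _ : J => Tp ∪ Tm).indicator
          (fun q => if Y q = j then ∏ i, F i (q i) else 0) q ∂Measure.pi (fun _ : J => ν) ≤
        c * ∫⁻ q, (Set.pi Set.univ fun _ : J => Tp ∪ Tm).indicator (fun q => ∏ i, F i (q i)) q
          ∂Measure.pi (fun _ : J => ν) := by
  intro J T _ _ _ ν _ Tp Tm hTp hTm hdisj F hF hGfin hGpos Y hY hmono c hanti j
  set μJ : Measure (J → T) := Measure.pi fun _ : J => ν with hμJ
  set Box : Set (J → T) := Set.pi Set.univ fun _ : J => Tp ∪ Tm with hBox_def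
  set G : J → Bool → ℝ≥0∞ := fun i β => ∫⁻ u, (if β then Tp else Tm).indicator (F i) u ∂ν
    with hG_def
  set hj : (J → T) → ℝ≥0∞ := fun q => if Y q = j then 1 else 0 with hhj_def
  set mix : (J → Bool) → (J → T) × (J → T) → (J → T) := fun σ z i => if σ i then z.1 i else z.2 i
    with hmix_def
  set Pp : (J → T) → ℝ≥0∞ := fun q => ∏ i, Tp.indicator (F i) (q i) with hPp_def
  set Pm : (J → T) → ℝ≥0∞ := fun q => ∏ i, Tm.indicator (F i) (q i) with hPm_def
  set W : ℝ≥0∞ := (∏ i, G i true) * ∏ i, G i false with hW_def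
  set Tot : ℝ≥0∞ := ∑ σ : J → Bool, ∏ i, G i (σ i) with hTot_def
  -- measurability
  have hTβ : ∀ β : Bool, MeasurableSet (if β then Tp else Tm) := by
    rintro (_ | _) <;> simp [hTp, hTm]
  have hind : ∀ (i : J) (β : Bool), Measurable ((if β then Tp else Tm).indicator (F i)) :=
    fun i β => (hF i).indicator (hTβ β)
  have hYj : MeasurableSet {q : J → T | Y q = j} := hY (measurableSet_singleton j)
  have hhjm : Measurable hj := Measurable.ite hYj measurable_const measurable_const
  have hmixm : ∀ σ, Measurable (mix σ) := fun σ =>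
    measurable_pi_lambda _ fun i => Measurable.ite (MeasurableSet.const _)
      ((measurable_pi_apply i).comp measurable_fst) ((measurable_pi_apply i).comp measurable_snd)
  have hPpm : Measurable Pp :=
    Finset.measurable_prod (f := fun (i : J) (q : J → T) => Tp.indicator (F i) (q i))
      _ fun i _ => ((hF i).indicator hTp).comp (measurable_pi_apply i)
  have hPmm : Measurable Pm :=
    Finset.measurable_prod (f := fun (i : J) (q : J → T) => Tm.indicator (F i) (q i))
      _ fun i _ => ((hF i).indicator hTm).comp (measurable_pi_apply i)
  have hRm : Measurable fun z : (J → T) × (J → T) => Pp z.1 * Pm z.2 :=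
    (hPpm.comp measurable_fst).mul (hPmm.comp measurable_snd)
  have hmeasR : ∀ σ : J → Bool,
      Measurable fun z : (J → T) × (J → T) => hj (mix σ z) * (Pp z.1 * Pm z.2) :=
    fun σ => (hhjm.comp (hmixm σ)).mul hRm
  -- one-coordinate masses
  have hGt : ∀ i, G i true = ∫⁻ u, Tp.indicator (F i) u ∂ν := fun i => by simp [hG_def]
  have hGf : ∀ i, G i false = ∫⁻ u, Tm.indicator (F i) u ∂ν := fun i => by simp [hG_def]
  have hIp : ∫⁻ q, Pp q ∂μJ = ∏ i, G i true := by
    simp only [hGt, hPp_def]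
    exact spread_lintegral_prod_pi ν fun i => (hF i).indicator hTp
  have hIm : ∫⁻ q, Pm q ∂μJ = ∏ i, G i false := by
    simp only [hGf, hPm_def]
    exact spread_lintegral_prod_pi ν fun i => (hF i).indicator hTm
  have hW0 : W ≠ 0 :=
    mul_ne_zero (Finset.prod_ne_zero_iff.2 fun i _ => hGpos i true)
      (Finset.prod_ne_zero_iff.2 fun i _ => hGpos i false)
  have hWtop : W ≠ ∞ :=
    ENNReal.mul_ne_top (ENNReal.prod_ne_top fun i _ => hGfin i true)
      (ENNReal.prod_ne_top fun i _ => hGfin i false)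
  -- total mass
  have htot : ∫⁻ q, Box.indicator (fun q => ∏ i, F i (q i)) q ∂μJ = Tot := by
    rw [hBox_def, hμJ, spread_lintegral_pattern_total ν hTp hTm hdisj hF]
  -- the atom as a pattern sum
  have hpatt : ∀ q, Box.indicator (fun q => ∏ i, F i (q i)) q =
      ∑ σ : J → Bool, ∏ i, (if σ i then Tp else Tm).indicator (F i) (q i) := by
    intro q
    have := spread_pattern_pointwise hdisj F (fun _ => True) q
    simpa using this
  have hLHS_pt : ∀ q, Box.indicator (fun q => if Y q = j then ∏ i, F i (q i) else 0) q =
      ∑ σ : J → Bool, hj q * ∏ i, (if σ i then Tp else Tm).indicator (F i) (q i) := by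
    intro q
    rw [← Finset.mul_sum, ← hpatt q]
    by_cases hq : q ∈ Box
    · rw [indicator_of_mem hq, indicator_of_mem hq]
      by_cases hYq : Y q = j
      · simp [hhj_def, hYq]
      · simp [hhj_def, hYq]
    · rw [indicator_of_notMem hq, indicator_of_notMem hq, mul_zero]
  set A : (J → Bool) → ℝ≥0∞ := fun σ =>
    ∫⁻ q, hj q * ∏ i, (if σ i then Tp else Tm).indicator (F i) (q i) ∂μJ with hA_def
  have hmeasA : ∀ σ : J → Bool,
      Measurable fun q : J → T => hj q * ∏ i, (if σ i then Tp else Tm).indicator (F i) (q i) :=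
    fun σ => hhjm.mul (Finset.measurable_prod
      (f := fun (i : J) (q : J → T) => (if σ i then Tp else Tm).indicator (F i) (q i))
      _ fun i _ => (hind i (σ i)).comp (measurable_pi_apply i))
  have hLHS : ∫⁻ q, Box.indicator (fun q => if Y q = j then ∏ i, F i (q i) else 0) q ∂μJ =
      ∑ σ, A σ := by
    simp_rw [hLHS_pt]
    exact lintegral_finsetSum _ fun σ _ => hmeasA σ
  -- the coupling, pattern by pattern
  have hB : ∀ σ : J → Bool,
      ∫⁻ z, hj (mix σ z) * (Pp z.1 * Pm z.2) ∂μJ.prod μJ = (∏ i, G i (!σ i)) * A σ := by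
    intro σ
    have hcpl := fam_coupling_identity ν hTp hTm hF hhjm σ
    have hG' : ∀ i, G i (!σ i) = ∫⁻ u, (if σ i then Tm else Tp).indicator (F i) u ∂ν := by
      intro i; cases σ i <;> simp [hG_def]
    simp only [hG']
    exact hcpl
  have hWσ : ∀ σ : J → Bool, (∏ i, G i (σ i)) * ∏ i, G i (!σ i) = W := by
    intro σ
    rw [hW_def, ← Finset.prod_mul_distrib, ← Finset.prod_mul_distrib]
    exact Finset.prod_congr rfl fun i _ => by cases σ i <;> simp [mul_comm]
  -- main estimate: multiply by `W` and bound pointwise in the representatives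
  have hmain : W * ∑ σ, A σ ≤ W * (c * Tot) := by
    calc W * ∑ σ, A σ
        = ∑ σ, (∏ i, G i (σ i)) * ∫⁻ z, hj (mix σ z) * (Pp z.1 * Pm z.2) ∂μJ.prod μJ := by
          rw [Finset.mul_sum]
          refine Finset.sum_congr rfl fun σ _ => ?_
          rw [hB σ, ← mul_assoc, hWσ σ]
      _ = ∫⁻ z, ∑ σ, (∏ i, G i (σ i)) * (hj (mix σ z) * (Pp z.1 * Pm z.2)) ∂μJ.prod μJ := by
          rw [lintegral_finsetSum]
          · refine Finset.sum_congr rfl fun σ _ => ?_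
            exact (lintegral_const_mul _ (hmeasR σ)).symm
          · intro σ _
            exact (hmeasR σ).const_mul _
      _ = ∫⁻ z, (∑ σ, (∏ i, G i (σ i)) * hj (mix σ z)) * (Pp z.1 * Pm z.2) ∂μJ.prod μJ := by
          refine lintegral_congr fun z => ?_
          rw [Finset.sum_mul]
          exact Finset.sum_congr rfl fun σ _ => (mul_assoc _ _ _).symm
      _ ≤ ∫⁻ z, (c * Tot) * (Pp z.1 * Pm z.2) ∂μJ.prod μJ := by
          refine lintegral_mono fun z => ?_
          by_cases hz : Pp z.1 * Pm z.2 = 0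
          · rw [hz, mul_zero, mul_zero]
          refine mul_le_mul_left ?_ _
          -- the representatives sit in the templates
          have hz1 : ∀ i, z.1 i ∈ Tp := fun i => by
            by_contra hni
            apply hz
            have hP : Pp z.1 = 0 := by
              rw [hPp_def]
              exact Finset.prod_eq_zero (Finset.mem_univ i) (indicator_of_notMem hni _)
            rw [hP, zero_mul]
          have hz2 : ∀ i, z.2 i ∈ Tm := fun i => by
            by_contra hni
            apply hz
            have hP : Pm z.2 = 0 := by
              rw [hPm_def]
              exact Finset.prod_eq_zero (Finset.mem_univ i) (indicator_of_notMem hni _)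
            rw [hP, mul_zero]
          -- the level set of the mixed statistic is an antichain
          set 𝒜z : Finset (J → Bool) := Finset.univ.filter fun σ => Y (mix σ z) = j with h𝒜z
          have hsum : ∑ σ, (∏ i, G i (σ i)) * hj (mix σ z) = ∑ σ ∈ 𝒜z, ∏ i, G i (σ i) := by
            rw [h𝒜z, Finset.sum_filter]
            refine Finset.sum_congr rfl fun σ _ => ?_
            simp only [hhj_def, mul_ite, mul_one, mul_zero]
          have hanti_z : ∀ s ∈ 𝒜z, ∀ s' ∈ 𝒜z, (∀ i, s i ≤ s' i) → s = s' := by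
            intro s hs s' hs' hle
            simp only [h𝒜z, Finset.mem_filter, Finset.mem_univ, true_and] at hs hs'
            exact fam_mix_antichain hmono z.1 z.2 hz1 hz2 s s' hle j hs hs'
          rw [hsum]
          exact hanti 𝒜z hanti_z
      _ = (c * Tot) * ∫⁻ z, Pp z.1 * Pm z.2 ∂μJ.prod μJ := lintegral_const_mul _ hRm
      _ = (c * Tot) * W := by
          rw [lintegral_prod_mul hPpm.aemeasurable hPmm.aemeasurable, hIp, hIm]
      _ = W * (c * Tot) := mul_comm _ _
  have hfin : ∑ σ, A σ ≤ c * Tot := (ENNReal.mul_le_mul_iff_right hW0 hWtop).1 hmain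
  rw [hLHS, htot]
  exact hfin

end Summit.QuantumFields.QCD.Cruxes.WindowExtinction.FreeVolumeHeavyWitness

end
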